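import Literature.Analysis.FluidPDE.NSCriticalClosureHolds
import HarnessLib

/-!
# The `L³` continuation criterion with the printed `L_{3,∞}(Q_T)` (essential supremum) hypothesis

Analysis/FluidPDE proofs-only file (theorems only: no definition, no named fact, no `sorry`).

The tree's `L³` continuation criterion
`Literature.Analysis.FluidPDE.hasSmoothExtensionPast_of_eLpNorm_three_bounded`
(`NSCriticalClosure.lean`; G. Seregin, Comm. Math. Phys. 312 (2012), Thm. 1.1, in the `limsup`
form of L. Escauriaza, G. Seregin, V. Šverák, Russ. Math. Surveys 58 (2003), Thms. 1.3–1.4;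
DISCHARGED: `hasSmoothExtensionPast_of_eLpNorm_three_bounded_holds`, `NSCriticalClosureHolds.lean`)
is stated with the POINTWISE-in-time bound `sup_{0 ≤ t < T} ‖u(t)‖_{L³} < ∞` over every slice of
the classical solution. The printed hypothesis of ESS 2003, Thm. 1.4 — "Let `v` be a Leray–Hopf
weak solution of the Cauchy problem in `Q_T` with `v ∈ L_{3,∞}(Q_T)`; then `v` is smooth" — and of
its textbook form Robinson–Rodrigo–Sadowski 2016, Thm. 16.4 ("`u ∈ L^∞(0, T; L³(ℝ³))` ⇒ `u` is
actually smooth (and hence unique)") is membership in the MIXED class `L^∞(0, T; L³)`, an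
ESSENTIAL supremum in time: the tree's guarded `MemLqLp ∞ 3 u (Ioo 0 T)` (`LerayHopf.lean`), which
is also the hypothesis of the named fact `ess_endpoint` and the conclusion of the strong hypothesis
`Literature.StrongHypotheses.NavierStokesRegularity.LerayHopfLThreeBound`.

For a classical solution on `[0, T)` the two hypotheses agree. RRS 2016 carry out exactly this
passage as Step 1 of the proof of Thm. 16.4 (p. 336 of the book: "Show that `u(t)` is bounded in
`L³` for every `t ∈ [0, T)`. Notice that the assumption `u ∈ L^∞(0,T;L³(ℝ³))` only guarantees a
priori that `u ∈ L³(ℝ³)` for almost every `t`"), there by weak continuity; for a field with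
continuous slices and continuous time lines it is Fatou's lemma along good times `sₙ ↓ t`:
`‖u(t)‖₃ ≤ liminf ‖u(sₙ)‖₃ ≤ ‖u‖_{L^∞(0,T;L³)}`. This file records the passage and the resulting
form of the criterion:

* `exists_mem_Ioo_right_of_ae` — an a.e. property on `(0, T)` holds at some time of every
  interval `(t, t + ε)`, `t ∈ [0, T)`;
* `eLpNorm_le_of_ae_eLpNorm_le_of_continuousWithinAt` — the Fatou transfer of an a.e.-in-time
  bound `‖u(s)‖_{L^p} ≤ M` to EVERY `t ∈ [0, T)` (general measure space, exponent and target);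
* `eLpNorm_le_eLqLpNorm_of_continuousOn`, `iSup_eLpNorm_lt_top_of_memLqLp_top` — for a field
  jointly continuous on `[0, T) × ℝ³`: `‖u(t)‖_{L^p} ≤ ‖u‖_{L^∞(0,T;L^p)}` for every `t ∈ [0, T)`,
  hence `sup_{[0,T)} ‖u(t)‖_{L^p} < ∞` from `MemLqLp ∞ p u (Ioo 0 T)`;
* `hasSmoothExtensionPast_of_memLqLp_top_three` — **the `L³` continuation criterion with the
  printed `L_{3,∞}` hypothesis**: a classical solution of the unforced system on `ℝ³ × [0, T)`,
  Leray–Hopf on `[0, T]` from its rapidly decaying datum `u(0)`, with `u ∈ L^∞(0, T; L³(ℝ³))`,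
  extends as a classical solution past `T` (ESS 2003, Thm. 1.4 with the local theory; Seregin
  2012, Thm. 1.1, contrapositive: "Let `T > 0` be a finite blow up time. Then
  `lim_{t→T−0} ‖v(·,t)‖₃ = ∞`").

## References

* L. Escauriaza, G. Seregin, V. Šverák, *`L_{3,∞}`-solutions of Navier–Stokes equations and
  backward uniqueness*, Russ. Math. Surveys 58:2 (2003) 211–250, Thms. 1.3–1.4.
  [`EscauriazaSereginSverak2003`]
* G. Seregin, *A certain necessary condition of potential blow up for Navier–Stokes equations*,
  Comm. Math. Phys. 312 (2012) 833–845 = arXiv:1104.3615, Thm. 1.1 and (1.6) (p. 2).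
  [`Seregin2012CMP`]
* J. C. Robinson, J. L. Rodrigo, W. Sadowski, *The Three-Dimensional Navier–Stokes Equations*,
  CUP (2016), §16.4, Thm. 16.4 and Step 1 of its proof (book p. 336). [`RobinsonRodrigoSadowski2016`]
-/

noncomputable section

open MeasureTheory Set Function Filter
open _root_.Topology
open scoped ENNReal NNReal

namespace Literature.Analysis.FluidPDE

/-! ### Good times in every right neighbourhood -/

/-- If `P s` holds for a.e. `s ∈ (0, T)`, then for every `t ∈ [0, T)` and every `ε > 0` it holds
at some time `s ∈ (t, min T (t + ε))` — an interval of positive length inside `(0, T)`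
(`exists_mem_Ioo_of_ae_restrict`). [folklore] -/
theorem exists_mem_Ioo_right_of_ae {T t ε : ℝ} {P : ℝ → Prop}
    (h : ∀ᵐ s ∂((volume : Measure ℝ).restrict (Ioo 0 T)), P s) (ht : t ∈ Ico 0 T) (hε : 0 < ε) :
    ∃ s ∈ Ioo t (min T (t + ε)), P s := by
  have hsub : Ioo t (min T (t + ε)) ⊆ Ioo 0 T := fun s hs =>
    ⟨ht.1.trans_lt hs.1, hs.2.trans_le (min_le_left _ _)⟩
  exact exists_mem_Ioo_of_ae_restrict (lt_min ht.2 (by linarith))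
    (ae_restrict_of_ae_restrict_of_subset hsub h)

/-! ### Fatou: an a.e.-in-time slice bound holds at every time of continuity -/

section Fatou

variable {X : Type*} [MeasureSpace X] {F : Type*} [NormedAddCommGroup F]

/-- **Fatou transfer of an a.e.-in-time slice bound to every time.** Let `u : ℝ → X → F` have
a.e.-strongly measurable slices `u t`, `t ∈ [0, T)`, and time lines `s ↦ u s x` continuous within
`[0, T)` at every `t ∈ [0, T)` (every `x`). If `‖u s‖_{L^p} ≤ M` for a.e. `s ∈ (0, T)`, then
`‖u t‖_{L^p} ≤ M` for EVERY `t ∈ [0, T)`: choose good times `sₙ ∈ (t, t + 1/(n+1))` carrying the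
bound (`exists_mem_Ioo_right_of_ae`), so that `sₙ → t` within `[0, T)` and `u sₙ → u t` pointwise,
and apply Fatou's lemma in `L^p` (Mathlib `Lp.eLpNorm_lim_le_liminf_eLpNorm`):
`‖u t‖_p ≤ liminf ‖u sₙ‖_p ≤ M`. [folklore] -/
theorem eLpNorm_le_of_ae_eLpNorm_le_of_continuousWithinAt {T : ℝ} {u : ℝ → X → F} {p M : ℝ≥0∞}
    (hmeas : ∀ t ∈ Ico 0 T, AEStronglyMeasurable (u t) volume)
    (hcont : ∀ t ∈ Ico 0 T, ∀ x, ContinuousWithinAt (fun s => u s x) (Ico 0 T) t)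
    (hae : ∀ᵐ s ∂((volume : Measure ℝ).restrict (Ioo 0 T)), eLpNorm (u s) p volume ≤ M)
    {t : ℝ} (ht : t ∈ Ico 0 T) : eLpNorm (u t) p volume ≤ M := by
  -- good times `s n ∈ (t, min T (t + 1/(n+1)))` carrying the bound
  have hex : ∀ n : ℕ, ∃ s ∈ Ioo t (min T (t + 1 / ((n : ℝ) + 1))), eLpNorm (u s) p volume ≤ M :=
    fun n => exists_mem_Ioo_right_of_ae hae ht Nat.one_div_pos_of_nat
  choose s hs hsM using hex
  have hsT : ∀ n, s n ∈ Ico 0 T := fun n =>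
    ⟨ht.1.trans (hs n).1.le, (hs n).2.trans_le (min_le_left _ _)⟩
  -- `s n → t` within `[0, T)`
  have hst : Tendsto s atTop (𝓝 t) := by
    have h1 : Tendsto (fun n : ℕ => t + 1 / ((n : ℝ) + 1)) atTop (𝓝 t) := by
      simpa only [add_zero] using
        tendsto_const_nhds.add (tendsto_one_div_add_atTop_nhds_zero_nat (𝕜 := ℝ))
    exact tendsto_of_tendsto_of_tendsto_of_le_of_le tendsto_const_nhds h1
      (fun n => (hs n).1.le) fun n => ((hs n).2.trans_le (min_le_right _ _)).le
  have hstW : Tendsto s atTop (𝓝[Ico 0 T] t) :=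
    tendsto_nhdsWithin_iff.2 ⟨hst, Eventually.of_forall hsT⟩
  -- pointwise convergence of the slices along the good times
  have hlim : ∀ᵐ x ∂(volume : Measure X), Tendsto (fun n => u (s n) x) atTop (𝓝 (u t x)) :=
    Eventually.of_forall fun x => (hcont t ht x).tendsto.comp hstW
  -- Fatou in `L^p`
  calc eLpNorm (u t) p volume ≤ atTop.liminf fun n => eLpNorm (u (s n)) p volume :=
        Lp.eLpNorm_lim_le_liminf_eLpNorm (fun n => hmeas _ (hsT n)) (u t) hlim
    _ ≤ atTop.liminf fun _ : ℕ => M := liminf_le_liminf (Eventually.of_forall hsM)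
    _ = M := liminf_const _

end Fatou

/-! ### Jointly continuous fields: the mixed class `L^∞(0,T;L^p)` bounds every slice -/

section Classical

variable {T : ℝ} {u : ℝ → EuclideanSpace ℝ (Fin 3) → EuclideanSpace ℝ (Fin 3)}

/-- **From the essential to the pointwise-in-time `L^p` bound.** For a field `u` jointly
continuous on `[0, T) × ℝ³`, membership in `L^∞(0, T; L^p(ℝ³))` — the guarded
`MemLqLp ∞ p u (Ioo 0 T)`, an essential supremum in time — bounds `‖u(t)‖_{L^p}` at EVERY
`t ∈ [0, T)` by the mixed norm `‖u‖_{L^∞(0,T;L^p)}`: the slices are continuous (hence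
measurable), the time lines are continuous within `[0, T)`, the a.e. bound is
`MemLqLp.ae_eLpNorm_le_top`, and `eLpNorm_le_of_ae_eLpNorm_le_of_continuousWithinAt` (Fatou)
transfers it. This is Step 1 of the proof of Robinson–Rodrigo–Sadowski 2016, Thm. 16.4 ("`u(t)`
is bounded in `L³` for every `t ∈ [0, T)`", there for weak solutions, by weak continuity).
[cite: RobinsonRodrigoSadowski2016, Thm. 16.4, proof, Step 1 (p. 336)] -/
theorem eLpNorm_le_eLqLpNorm_of_continuousOn {p : ℝ≥0∞}
    (hcont : ContinuousOn (uncurry u) (Ico 0 T ×ˢ univ)) (hu : MemLqLp ∞ p u (Ioo 0 T))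
    {t : ℝ} (ht : t ∈ Ico 0 T) : eLpNorm (u t) p volume ≤ eLqLpNorm ∞ p u (Ioo 0 T) := by
  have hslice : ∀ τ ∈ Ico 0 T, Continuous (u τ) := fun τ hτ =>
    hcont.comp_continuous (continuous_const.prodMk continuous_id) fun x => ⟨hτ, mem_univ x⟩
  refine eLpNorm_le_of_ae_eLpNorm_le_of_continuousWithinAt
    (fun τ hτ => (hslice τ hτ).aestronglyMeasurable) (fun τ hτ x => ?_) hu.ae_eLpNorm_le_top ht
  have h1 : ContinuousWithinAt (uncurry u) (Ico 0 T ×ˢ univ) (τ, x) := hcont (τ, x) ⟨hτ, mem_univ x⟩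
  have h2 : ContinuousWithinAt (fun s : ℝ => ((s, x) : ℝ × EuclideanSpace ℝ (Fin 3)))
      (Ico 0 T) τ :=
    (continuous_id.prodMk continuous_const).continuousWithinAt
  exact ContinuousWithinAt.comp (f := fun s : ℝ => ((s, x) : ℝ × EuclideanSpace ℝ (Fin 3)))
    (x := τ) h1 h2 fun s hs => ⟨hs, mem_univ x⟩

/-- For a field jointly continuous on `[0, T) × ℝ³`, `u ∈ L^∞(0, T; L^p)` (`MemLqLp ∞ p u (Ioo 0 T)`,
essential supremum in time) gives the pointwise-in-time bound `sup_{0 ≤ t < T} ‖u(t)‖_{L^p} < ∞`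
— the hypothesis shape of the tree's `hasSmoothExtensionPast_of_eLpNorm_three_bounded`
(Robinson–Rodrigo–Sadowski 2016, proof of Thm. 16.4, Step 1).
[cite: RobinsonRodrigoSadowski2016, Thm. 16.4, proof, Step 1 (p. 336)] -/
theorem iSup_eLpNorm_lt_top_of_memLqLp_top {p : ℝ≥0∞}
    (hcont : ContinuousOn (uncurry u) (Ico 0 T ×ˢ univ)) (hu : MemLqLp ∞ p u (Ioo 0 T)) :
    (⨆ t ∈ Ico 0 T, eLpNorm (u t) p volume) < ⊤ :=
  lt_of_le_of_lt (iSup₂_le fun _ ht => eLpNorm_le_eLqLpNorm_of_continuousOn hcont hu ht) hu.2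

/-- **The `L³` continuation criterion with the printed `L_{3,∞}(Q_T)` hypothesis**
(Escauriaza–Seregin–Šverák 2003, Thm. 1.4: a Leray–Hopf weak solution of the Cauchy problem with
`v ∈ L_{3,∞}(Q_T)` is smooth on `Q_T`, so `T` is not a blow-up time of a smooth solution in this
class; Seregin 2012, Thm. 1.1, contrapositive: at a finite blow-up time `‖v(·,t)‖₃ → ∞`;
Robinson–Rodrigo–Sadowski 2016, Thm. 16.4). Let `ν > 0`, `T > 0`, and let `(u, p)` be a classical
solution of the unforced system on `ℝ³ × [0, T)` which is Leray–Hopf on `[0, T]` from its rapidly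
decaying datum `u(0)` and lies in `L^∞(0, T; L³(ℝ³))` (`MemLqLp ∞ 3 u (Ioo 0 T)`). Then `u`
extends as a classical solution past `T`. Proof: by `iSup_eLpNorm_lt_top_of_memLqLp_top` the
velocity, jointly continuous on `[0, T) × ℝ³`, has `sup_{[0,T)} ‖u(t)‖₃ < ∞`, and the discharged
criterion `hasSmoothExtensionPast_of_eLpNorm_three_bounded_holds` applies.
[cite: EscauriazaSereginSverak2003, Thm. 1.4] [cite: Seregin2012CMP, Thm. 1.1]
[cite: RobinsonRodrigoSadowski2016, Thm. 16.4] -/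
theorem hasSmoothExtensionPast_of_memLqLp_top_three {ν : ℝ} (hν : 0 < ν) (hT : 0 < T)
    {p : ℝ → EuclideanSpace ℝ (Fin 3) → ℝ} (hsol : IsClassicalNSSolutionOn (Ico 0 T) ν 0 u p)
    (hLH : IsLerayHopfOn T ν 0 (u 0) u) (h₀ : HasRapidSpatialDecay (u 0))
    (h₃ : MemLqLp ∞ 3 u (Ioo 0 T)) : HasSmoothExtensionPast ν 0 u T :=
  hasSmoothExtensionPast_of_eLpNorm_three_bounded_holds ν T hν hT u p hsol hLH h₀
    (iSup_eLpNorm_lt_top_of_memLqLp_top hsol.smooth_velocity.continuousOn h₃)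

end Classical

end Literature.Analysis.FluidPDE

end
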